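import Mathlib
import HarnessLib
import Summits.NavierStokesRegularity.NavierStokesRegularity.Theses.PoloidalWindowDoor
import Summits.NavierStokesRegularity.NavierStokesRegularity.Theorems.ScarRigidity.Negative.LogicAndLoadBearing
import Summits.NavierStokesRegularity.NavierStokesRegularity.Theorems.SymmetryModuliCountSymmetricLiouville
import Summits.NavierStokesRegularity.NavierStokesRegularity.Theorems.SymmetryModuliCountAxisymEndLiouville
import Summits.NavierStokesRegularity.NavierStokesRegularity.Theorems.PoloidalWindowDoorPoloidalWindowRigidityWindow
import Summits.NavierStokesRegularity.NavierStokesRegularity.Theorems.PoloidalWindowDoorPoloidalWindowRigiditySharper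
import Summits.NavierStokesRegularity.NavierStokesRegularity.Theorems.PoloidalWindowDoorPoloidalWindowRigidityK2OfLrcSpatial
import Summits.NavierStokesRegularity.NavierStokesRegularity.Theorems.PoloidalWindowDoorPoloidalWindowRigidityHorizontalFlatPast
import Summits.NavierStokesRegularity.NavierStokesRegularity.Theorems.PoloidalWindowDoorPoloidalWindowRigidityTimeShearLiminf
import Summits.NavierStokesRegularity.NavierStokesRegularity.Theorems.PoloidalWindowDoorPoloidalWindowRigidityStubUntwisted
import Summits.NavierStokesRegularity.NavierStokesRegularity.Theorems.PoloidalWindowDoorPoloidalWindowRigidityThmAThreeStubs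
import Summits.NavierStokesRegularity.NavierStokesRegularity.Theorems.PoloidalWindowDoorPoloidalWindowRigidityThmARelocation


/-!
# SKELETON `period_door` (v3) — crux `PoloidalWindowRigidity` (K2, stmt-NavierStokesRegularity-19708), route `PoloidalWindowDoor`
# IDEATOR seat ns-idea-8 g3, LINE 7 (lens «barrier»; target LADDER-NS N0, THICK column).  Navier–Stokes regularity is NOT proved by this
# file and no crux is proved by this file: it is a registered decomposition of ONE crux with FOUR `sorry`-stubs (v3) — one SHARED VERBATIM with
# registered lines (`stub_hyperbolicTH`: mixed_type / z_shock / string_shells), ONE finite-dimensional geometry stub (`stub_killingOfDiscreteRotation`,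
# D1F: a discrete Euclidean symmetry of infinite order with a fixed point integrates to a Killing ROTATION symmetry — density of irrational rotations +
# continuity + one derivative; no PDE), two research residues (`stub_asymmetricHypThick`, `stub_asymmetricSemiThick`: the THICK cells WITHOUT a period and
# WITHOUT an infinite-order symmetry having a fixed point) — and a kernel-checked composition `PoloidalWindowRigidity_of_periodDoor` concluding the crux
# BY NAME.  The two DOORS are PROVED here BY NAME over tree theorems: D0 `periodDoor` (one period ⇒ `v ≡ 0` ⇒ not singular:
# `…Theorems.SymmetryModuliCountSymmetricLiouville.periodicTypeIAncientLiouville`, landed 2026-08-16 by route SymmetryModuliCount's line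
# `blowdown-kills-pitch`, via the class dictionary `…PoloidalWindowDoorPoloidalWindowRigidityWindow.isTypeIAncientMild_of_class`) and D1F⁺ `rotationDoor`
# (infinite-order symmetry with a fixed point ⇒ [stub D1F] Killing rotation symmetry about an axis ⇒ `v ≡ 0` by `…Theorems.AxisymEndLiouville_of`
# = item stmt-14061 `AxisymEndLiouville` PROVED, any axis, swirl allowed).

v3 (2026-08-28T14Z) = THE CRITIC'S BC4 FINDING APPLIED (idea-crit-7 g2, REQUESTS 13:09:25Z / 13:18:45Z): the period door D0 and the fixed-point half of the
symmetry door are KNOWN-IN-TREE; v1's energy-per-cell plan and v2's blow-down squeeze were re-derivations of the Aug-16 lever («discrete translations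
are free»: F3 class compactness + rotation covariance ⇒ blow-down ⇒ Kato gap at −∞) and are WITHDRAWN as proof plans (v2.2's kernel-checked
`affine_dichotomy`, `blowdown_squeeze_zero`, the stubs D1L/D1T are banked in tree history, commit 3dd2ca2f5d9a, and not used here).  The «∀ K» scaled-energy
hypotheses of v1–v2.2 were DECORATION for the doors and are DROPPED everywhere (the velocity half of that floor is itself the tree theorem
`…Theorems.FarPastLedger_proof`, item stmt-14060; residue provers invoke it by name); F0 `stub_scaledEnergy` is no longer a stub of this line.
P4 (irrational screw) is WITHDRAWN, with the reason (v3 finding, put to the critic): for a discrete screw `g = (R_α, ℓe)`, `α/2π` irrational, `ℓ ≠ 0`,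
blow-downs centred at bounded distance from the axis inherit tuned iterates and their limits vanish (axisymmetric + axially invariant), but the Kato
gap `…SymmetricLiouville.stub_smallAtMinusInfinityLiouville` needs smallness of `√(−t)‖v(t)‖_∞` UNIFORMLY IN `x`, and blow-downs re-centred at distance
`d ≫ λ` from the axis inherit only the conjugated symmetry `(R_α, (ℓe + (R_α − 1)(x_k − c))/λ)` whose translation part diverges — the injectivity
radius of `ℝ³/⟨g⟩` at distance `d` grows like `√(dℓ)` — so far from its axis a discrete irrational screw imposes NO local constraint; unlike a period
(re-centring commutes with translations, which is why the tree's `stub_periodicBlowdownVanishing` is uniform).  The irrational screw therefore joins the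
RESIDUE side (it is neither a period nor a fixed-point symmetry): typed, not claimed.

THE DOOR HYPOTHESIS (v3, explicit; its negation is what the residues carry):
  `HDoor v :≡ (∃ p ≠ 0, ∀ t<0, ∀ x, v t (x + p) = v t x) ∨ (∃ (A : ℝ³ ≃ₗᵢ ℝ³) (c : ℝ³), (∀ q ≥ 1, ∃ x, A^[q] x ≠ x) ∧ ∀ t<0, ∀ x, v t (A (x − c) + c) = A (v t x))`
— a PERIOD (covers translations, rational screws, glide reflections, every n-fold screw-symmetric profile: their symmetry groups contain a non-zero
translation) OR an INFINITE-ORDER SYMMETRY WITH A FIXED POINT (irrational rotation / rotoreflection about any axis: the closure of its powers contains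
the rotation circle of the axis, so the slice is axisymmetric about that axis).  Finite point groups and irrational screws are correctly NOT doors.

* **D0 `periodDoor` — THEOREM (by name).**
* **D1F `stub_killingOfDiscreteRotation` — STUB (M; geometry: normal form of an infinite-order element of `O(3)` = rotation or rotoreflection by an angle
  incommensurable with π, Kronecker density, closedness of the equivariance group of a continuous slice, differentiation of the one-parameter rotation
  symmetry at the identity for the `C¹` slices of `A_C`).**
* **D1F⁺ `rotationDoor` — THEOREM from D1F (by name).**   **`symmetryDoor` — THEOREM: class + HDoor ⇒ not singular.**
* **R_H, R_S** (`stub_asymmetricHypThick`, `stub_asymmetricSemiThick`; research residues) — the hyperbolic-THICK and the semi-elliptic-slab THICK cells of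
  `…ThmAThreeStubs.twisting_regular_of_three` (binders VERBATIM = `mixed_type` v2 `stub_hyperbolicThick` / `stub_semiEllipticThick`) under `¬ HDoor`.
  Strictly weaker than the cells they replace (one hypothesis added).  HONEST PRICE (unchanged): this line does NOT advance the asymmetric residue — its
  wall is the cells' wall —; what it does is remove, at class level and BY NAME, every architecture with a period or a dense rotational symmetry from BOTH
  thick cells at once (singly-periodic vortex arrays, stacked layers, n-fold helices, rational screws and glides; irrationally-rotation-symmetric profiles).
* `stub_hyperbolicTH` — the (TH) cell, SHARED VERBATIM (string_shells / entire_slices / the local_rigidity certificate).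

COMPOSITION (kernel-checked; no `sorry` outside `stub_*`): `hyperbolicThick_of_periodDoor`, `semiEllipticThick_of_periodDoor` — the two THICK cells,
PROVED: `by_cases HDoor`; door ⇒ `symmetryDoor`; else the residue —; then VERBATIM the `mixed_type` v2 / `strain_tube` v2 chain `twisting_of_periodDoor`
(`twisting_regular_of_three`) → `ndRegular` (`…StubUntwisted.stub_untwisted`) → `lrcSpatial_of_stubs` → `tv_of_stubs` → `sliceSharpNonflatLiouville_of_periodDoor`
(`…K2OfLrcSpatial.nonflatLiouville_of_lrc_spatial`) → `PoloidalWindowRigidity_of_periodDoor : …Theses.PoloidalWindowDoor.PoloidalWindowRigidity`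
(`…Sharper.poloidalWindowRigidity_of_sliceSharpNonflatLiouville`).

BC4 LOG (critic price P6; searched 2026-08-28T13:40Z after the critic's finding — should have been run at v1 birth): tree decls now CITED BY NAME —
`…SymmetryModuliCountSymmetricLiouville.periodicTypeIAncientLiouville`, `.periodicLeaf` (continuous screw of non-zero pitch ⇒ periodic ⇒ 0),
`.classCompactness` (F3), `.stub_rotationCovariance`, `.stub_smallAtMinusInfinityLiouville` (Kato gap), `.stub_periodicBlowdownVanishing`,
`…Theorems.AxisymEndLiouville_of` (stmt-14061), `…Theorems.FarPastLedger_proof` (stmt-14060), `Cruxes/SymmetricLiouville/Lines/blowdown-kills-pitch.lean`,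
`Cruxes/AxisymEndLiouville/Lines/absorbing_axis_swirl_extinction.lean`; searches run: `rg 'periodicTypeIAncientLiouville|AxisymEndLiouville|FarPastLedger|
isTypeIAncientMild_of_class' lean/Summits`, the item list of `Theses/SymmetryModuliCount.lean`.  (M) IS LOAD-BEARING for every statement here (the
kinematic periodised Type-I witness of v1 is singular): every stub keeps the mild clause — `Cruxes/PoloidalWindowRigidity/Disproof.lean` honoured.

INSTRUMENT ROW: (a) symmetry group of every refuter witness — K-47 `twistProfile` (xₕ-lattice-periodic: HDoor holds, door D0), K-50 `thickProfile`,
K-52 `seField` (APERIODIC strain tube, no dense rotation: lands in R_S, as it must); (b) cheapest falsifier of the CUT: a THICK-NF (`THICK-NF-K2p5.md`) jet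
stratum forcing a period or a dense rotation — none recorded; the cut is by a closed condition, both sides typed; (c) cheapest falsifier of D1F: an
infinite-order `A ∈ O(3)` whose powers are not dense in the rotation circle of its axis — impossible (angle incommensurable with π).

DEAD LINES AVOIDED (HOME HANDOFF g0/g2, NOTES g3): no asymptotic-floor dichotomy, no tube Liouville, no recurrence forcing (symmetry is the HYPOTHESIS
of a door, never a conclusion claimed for extremals), no re-derivation of tree theorems (v1/v2 plans withdrawn), no screw claim.
-/


namespace Summit.NavierStokesRegularity.NavierStokesRegularity.Cruxes.PoloidalWindowRigidity.PeriodDoor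

open Set Function Metric MeasureTheory
open scoped RealInnerProductSpace InnerProductSpace Topology
open Literature.Analysis Literature.Analysis.FluidPDE
open Summit.NavierStokesRegularity.NavierStokesRegularity.Theorems.PoloidalWindowDoorPoloidalWindowRigiditySharper
open Summit.NavierStokesRegularity.NavierStokesRegularity.Theorems.PoloidalWindowDoorPoloidalWindowRigidityK2OfLrcSpatial
open Summit.NavierStokesRegularity.NavierStokesRegularity.Theorems.PoloidalWindowDoorPoloidalWindowRigidityHorizontalFlatPast
open Summit.NavierStokesRegularity.NavierStokesRegularity.Theorems.PoloidalWindowDoorPoloidalWindowRigidityThmAThreeStubs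
open Summit.NavierStokesRegularity.NavierStokesRegularity.Theorems.PoloidalWindowDoorPoloidalWindowRigidityThmARelocation

/-! ### Shared stubs (other columns; restated VERBATIM so that the composition is self-contained) -/

/-- **STUB (`stub_hyperbolicTH`) — SHARED VERBATIM with `Lines/mixed_type.lean` / `z_shock.lean` (`hH` of `twisting_regular_of_three`): hyperbolic
(TH) twisting windows are regular.**  Lines of record: string_shells (proved there from its own stubs), entire_slices.  Not re-cut here.
Why it might fail: as recorded there (`twistingTH_false_without_mild`: (M) load-bearing). -/
theorem stub_hyperbolicTH :
    ∀ (C : ℝ) (v : ℝ → EuclideanSpace ℝ (Fin 3) → EuclideanSpace ℝ (Fin 3)),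
      Literature.Analysis.FluidPDE.HasTypeITimeDecay C v →
      ContinuousOn (Function.uncurry v) (Set.Iio (0 : ℝ) ×ˢ Set.univ) →
      (∀ s t : ℝ, s < t → t < 0 → ∀ x, v t x =
        Literature.Analysis.UnboundedOperators.heatExtension (v s) (t - s) x -
          Literature.Analysis.FluidPDE.oseenDuhamel 1 s v v t x) →
      (∀ t < 0, Literature.Analysis.FluidPDE.VectorCalculus.IsDivFree (v t)) →
      (∀ s < 0, ∀ y, ⟪Literature.Analysis.FluidPDE.curl (v s) y, EuclideanSpace.single 2 1⟫_ℝ = 0) →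
      ∀ W : Set (ℝ × EuclideanSpace ℝ (Fin 3)), IsOpen W → W.Nonempty → W ⊆ Set.Iio (0 : ℝ) ×ˢ Set.univ →
        (∀ z ∈ W, Literature.Analysis.FluidPDE.curl (v z.1) z.2 ≠ 0 ∧
          (fderiv ℝ (v z.1) z.2 (EuclideanSpace.single 0 1) 2 ≠ 0 ∨ fderiv ℝ (v z.1) z.2 (EuclideanSpace.single 1 1) 2 ≠ 0) ∧
          (fderiv ℝ (v z.1) z.2 (EuclideanSpace.single 2 1) 0 ≠ 0 ∨ fderiv ℝ (v z.1) z.2 (EuclideanSpace.single 2 1) 1 ≠ 0)) →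
        (∀ m : ℝ → ℝ, ∀ W₁ : Set (ℝ × EuclideanSpace ℝ (Fin 3)), W₁ ⊆ W → IsOpen W₁ → W₁.Nonempty →
          ∃ z ∈ W₁, ∃ b : Fin 3, b ≠ 2 ∧
            fderiv ℝ (v z.1) z.2 (EuclideanSpace.single 2 1) b ≠
              m z.1 * fderiv ℝ (v z.1) z.2 (EuclideanSpace.single b 1) 2) →
        (∀ z ∈ W,
          fderiv ℝ (fun x => fderiv ℝ (v z.1) x (EuclideanSpace.single 2 1) 2) z.2 (EuclideanSpace.single 0 1) *
              fderiv ℝ (v z.1) z.2 (EuclideanSpace.single 1 1) 2 -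
            fderiv ℝ (fun x => fderiv ℝ (v z.1) x (EuclideanSpace.single 2 1) 2) z.2 (EuclideanSpace.single 1 1) *
              fderiv ℝ (v z.1) z.2 (EuclideanSpace.single 0 1) 2 ≠ 0) →
        (∀ z ∈ W,
          fderiv ℝ (v z.1) z.2 (EuclideanSpace.single 2 1) 0 * fderiv ℝ (v z.1) z.2 (EuclideanSpace.single 0 1) 2 +
            fderiv ℝ (v z.1) z.2 (EuclideanSpace.single 2 1) 1 * fderiv ℝ (v z.1) z.2 (EuclideanSpace.single 1 1) 2 < 0) →
        (∃ m : ℝ → ℝ → ℝ, ∀ z ∈ W, ∀ b : Fin 3, b ≠ 2 →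
          fderiv ℝ (v z.1) z.2 (EuclideanSpace.single 2 1) b =
            m z.1 (z.2 2) * fderiv ℝ (v z.1) z.2 (EuclideanSpace.single b 1) 2) →
        ¬ Literature.Analysis.FluidPDE.IsBackwardSingularPoint v 0 := by

  sorry

/-! ### The SYMMETRY DOORS (v3): D0 by name, D1F geometry stub + by name, `symmetryDoor` proved -/

/-- **D0 — THE PERIOD DOOR, PROVED BY NAME (critic BC4, 2026-08-28):** a profile of the route's Type-I class (rate, continuity on the open slab,
Oseen-mildness (M), incompressibility) that is periodic along some `p ≠ 0` vanishes identically on `t < 0`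
(`…SymmetryModuliCountSymmetricLiouville.periodicTypeIAncientLiouville`, via `isTypeIAncientMild_of_class`), hence is not backward-singular at the origin
(`…ScarRigidity.Negative.not_isBackwardSingularPoint_of_eq_zero`).  Covers every profile whose symmetry group contains a non-zero translation. -/
theorem periodDoor :
    ∀ (C : ℝ) (v : ℝ → EuclideanSpace ℝ (Fin 3) → EuclideanSpace ℝ (Fin 3)),
      Literature.Analysis.FluidPDE.HasTypeITimeDecay C v →
      ContinuousOn (Function.uncurry v) (Set.Iio (0 : ℝ) ×ˢ Set.univ) →
      (∀ s t : ℝ, s < t → t < 0 → ∀ x, v t x =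
        Literature.Analysis.UnboundedOperators.heatExtension (v s) (t - s) x -
          Literature.Analysis.FluidPDE.oseenDuhamel 1 s v v t x) →
      (∀ t < 0, Literature.Analysis.FluidPDE.VectorCalculus.IsDivFree (v t)) →
      (∃ p : EuclideanSpace ℝ (Fin 3), p ≠ 0 ∧ ∀ t : ℝ, t < 0 → ∀ x, v t (x + p) = v t x) →
      ¬ Literature.Analysis.FluidPDE.IsBackwardSingularPoint v 0 := by
  intro C v hrate hcont hmild hdiv hper
  obtain ⟨p, hp, hper⟩ := hper
  have hcl : Literature.Analysis.FluidPDE.IsTypeIAncientMild C v :=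
    Summit.NavierStokesRegularity.NavierStokesRegularity.Theorems.PoloidalWindowDoorPoloidalWindowRigidityWindow.isTypeIAncientMild_of_class
      hrate hcont hmild hdiv
  exact Summit.NavierStokesRegularity.NavierStokesRegularity.Theorems.ScarRigidity.Negative.not_isBackwardSingularPoint_of_eq_zero
    (Summit.NavierStokesRegularity.NavierStokesRegularity.Theorems.SymmetryModuliCountSymmetricLiouville.periodicTypeIAncientLiouville
      C v hcl p hp hper)

/-- **STUB D1F (`stub_killingOfDiscreteRotation`) — finite-dimensional geometry + continuity, size M, NO PDE:** an element of `A_C` equivariant under a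
Euclidean isometry `x ↦ A (x - c) + c` with `A` a linear isometry of INFINITE ORDER and `c` a fixed point is annihilated, on every slice, by a non-zero
skew generator `K` of rotations about an axis through `c`: `fderiv (v t) x (K (x - c)) - K (v t x) = 0`.  PROOF PLAN: an infinite-order `A ∈ O(3)` is a
rotation (or rotoreflection) by an angle `α` with `α/π` irrational about an axis `ℝe` (normal form; cf. the tree's `exists_conj_eq_smul_rotGen` for the
Lie-algebra side); the even powers of `A` are dense in the rotation circle `s ↦ exp(sK)` of that axis (Kronecker); the set of isometries under which the
CONTINUOUS slice `v(t)` is equivariant is closed, so `v(t, c + exp(sK)(x - c)) = exp(sK) v(t,x)` for all `s`; differentiate at `s = 0` (slices of `A_C`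
are `C¹`, `IsTypeIAncientMild.contDiff_slice`).  Why it might fail: only formalisation (normal form of `O(3)` elements in Mathlib). [folklore] -/
theorem stub_killingOfDiscreteRotation :
    ∀ (C : ℝ) (v : ℝ → EuclideanSpace ℝ (Fin 3) → EuclideanSpace ℝ (Fin 3)),
      Literature.Analysis.FluidPDE.IsTypeIAncientMild C v →
      ∀ (A : EuclideanSpace ℝ (Fin 3) ≃ₗᵢ[ℝ] EuclideanSpace ℝ (Fin 3)) (c : EuclideanSpace ℝ (Fin 3)),
        (∀ q : ℕ, 0 < q → ∃ x, (fun y => A y)^[q] x ≠ x) →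
        (∀ t : ℝ, t < 0 → ∀ x, v t (A (x - c) + c) = A (v t x)) →
        ∃ K : EuclideanSpace ℝ (Fin 3) →L[ℝ] EuclideanSpace ℝ (Fin 3), (∀ x, ⟪K x, x⟫_ℝ = 0) ∧ K ≠ 0 ∧
          ∀ t : ℝ, t < 0 → ∀ x, fderiv ℝ (v t) x (K (x - c)) - K (v t x) = 0 := by
  sorry

/-- **D1F⁺ — THE ROTATION DOOR, PROVED from D1F BY NAME:** an infinite-order symmetry with a fixed point makes every slice infinitesimally axisymmetric
about an axis through the fixed point (D1F), and a Type-I ancient mild field annihilated by the rotations about ANY axis vanishes on `t < 0`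
(`…Theorems.AxisymEndLiouville_of`, item stmt-NavierStokesRegularity-14061 of route SymmetryModuliCount, PROVED; `θ = 0`). -/
theorem rotationDoor :
    ∀ (C : ℝ) (v : ℝ → EuclideanSpace ℝ (Fin 3) → EuclideanSpace ℝ (Fin 3)),
      Literature.Analysis.FluidPDE.HasTypeITimeDecay C v →
      ContinuousOn (Function.uncurry v) (Set.Iio (0 : ℝ) ×ˢ Set.univ) →
      (∀ s t : ℝ, s < t → t < 0 → ∀ x, v t x =
        Literature.Analysis.UnboundedOperators.heatExtension (v s) (t - s) x -
          Literature.Analysis.FluidPDE.oseenDuhamel 1 s v v t x) →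
      (∀ t < 0, Literature.Analysis.FluidPDE.VectorCalculus.IsDivFree (v t)) →
      (∃ (A : EuclideanSpace ℝ (Fin 3) ≃ₗᵢ[ℝ] EuclideanSpace ℝ (Fin 3)) (c : EuclideanSpace ℝ (Fin 3)),
          (∀ q : ℕ, 0 < q → ∃ x, (fun y => A y)^[q] x ≠ x) ∧ ∀ t : ℝ, t < 0 → ∀ x, v t (A (x - c) + c) = A (v t x)) →
      ¬ Literature.Analysis.FluidPDE.IsBackwardSingularPoint v 0 := by
  intro C v hrate hcont hmild hdiv hsym
  obtain ⟨A, c, hA, hsym⟩ := hsym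
  have hcl : Literature.Analysis.FluidPDE.IsTypeIAncientMild C v :=
    Summit.NavierStokesRegularity.NavierStokesRegularity.Theorems.PoloidalWindowDoorPoloidalWindowRigidityWindow.isTypeIAncientMild_of_class
      hrate hcont hmild hdiv
  obtain ⟨K, hskew, hK, hKill⟩ := stub_killingOfDiscreteRotation C v hcl A c hA hsym
  have hz : ∀ t < (0 : ℝ), ∀ x, v t x = 0 :=
    Summit.NavierStokesRegularity.NavierStokesRegularity.Theorems.AxisymEndLiouville_of C v hcl c K 0 hskew hK le_rfl hKill
  exact Summit.NavierStokesRegularity.NavierStokesRegularity.Theorems.ScarRigidity.Negative.not_isBackwardSingularPoint_of_eq_zero hz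

/-- **THE SYMMETRY DOOR (v3), PROVED:** class + `HDoor` (a period, or an infinite-order symmetry with a fixed point) ⇒ not backward-singular. -/
theorem symmetryDoor :
    ∀ (C : ℝ) (v : ℝ → EuclideanSpace ℝ (Fin 3) → EuclideanSpace ℝ (Fin 3)),
      Literature.Analysis.FluidPDE.HasTypeITimeDecay C v →
      ContinuousOn (Function.uncurry v) (Set.Iio (0 : ℝ) ×ˢ Set.univ) →
      (∀ s t : ℝ, s < t → t < 0 → ∀ x, v t x =
        Literature.Analysis.UnboundedOperators.heatExtension (v s) (t - s) x -
          Literature.Analysis.FluidPDE.oseenDuhamel 1 s v v t x) →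
      (∀ t < 0, Literature.Analysis.FluidPDE.VectorCalculus.IsDivFree (v t)) →
      ((∃ p : EuclideanSpace ℝ (Fin 3), p ≠ 0 ∧ ∀ t : ℝ, t < 0 → ∀ x, v t (x + p) = v t x) ∨
            ∃ (A : EuclideanSpace ℝ (Fin 3) ≃ₗᵢ[ℝ] EuclideanSpace ℝ (Fin 3)) (c : EuclideanSpace ℝ (Fin 3)),
              (∀ q : ℕ, 0 < q → ∃ x, (fun y => A y)^[q] x ≠ x) ∧ ∀ t : ℝ, t < 0 → ∀ x, v t (A (x - c) + c) = A (v t x)) →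
      ¬ Literature.Analysis.FluidPDE.IsBackwardSingularPoint v 0 := by
  intro C v hrate hcont hmild hdiv hdoor
  rcases hdoor with hper | hrot
  · exact periodDoor C v hrate hcont hmild hdiv hper
  · exact rotationDoor C v hrate hcont hmild hdiv hrot

/-! ### This line's research residues: the two THICK cells under `¬ HDoor` -/

/-- **STUB R_H (`stub_asymmetricHypThick`; v1–v2.1 `stub_aperiodicHypThick` with the weaker exclusion «no period») — research residue: the HYPERBOLIC THICK cell under `¬ HDoor` (no period, no infinite-order symmetry with a fixed point).**  Binders VERBATIM the shared
cell `stub_hyperbolicThick` of `Lines/mixed_type.lean` v2 / `z_shock.lean` (class; poloidal along `e₃`; a nonempty open space–time set `W` on which the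
profile is non-degenerate, carries the v3 pin, TWISTS, is HYPERBOLIC `I < 0` and THICK (no slope `m(t,z)`)), plus `¬ HDoor`
(v3: no period and no infinite-order symmetry with a fixed point; v2.2: no infinite-order symmetry; v1: no period).  Strictly weaker than the cell (one hypothesis added).  Why it might be as hard as the cell: asymmetry is a closed
codimension-∞ exclusion and gives analysis nothing by itself — this line does not claim otherwise (module docstring, HONEST PRICE); the cell's own lines
(z_shock: autonomous shocks / modulated residual; mixed_type) attack it.  Honours `hyperbolicThick_false_without_mild` (mild kept verbatim). -/
theorem stub_asymmetricHypThick :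
    ∀ (C : ℝ) (v : ℝ → EuclideanSpace ℝ (Fin 3) → EuclideanSpace ℝ (Fin 3)),
      Literature.Analysis.FluidPDE.HasTypeITimeDecay C v →
      ContinuousOn (Function.uncurry v) (Set.Iio (0 : ℝ) ×ˢ Set.univ) →
      (∀ s t : ℝ, s < t → t < 0 → ∀ x, v t x =
        Literature.Analysis.UnboundedOperators.heatExtension (v s) (t - s) x -
          Literature.Analysis.FluidPDE.oseenDuhamel 1 s v v t x) →
      (∀ t < 0, Literature.Analysis.FluidPDE.VectorCalculus.IsDivFree (v t)) →
      (∀ s < 0, ∀ y, ⟪Literature.Analysis.FluidPDE.curl (v s) y, EuclideanSpace.single 2 1⟫_ℝ = 0) →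
      ∀ W : Set (ℝ × EuclideanSpace ℝ (Fin 3)), IsOpen W → W.Nonempty → W ⊆ Set.Iio (0 : ℝ) ×ˢ Set.univ →
        (∀ z ∈ W, Literature.Analysis.FluidPDE.curl (v z.1) z.2 ≠ 0 ∧
          (fderiv ℝ (v z.1) z.2 (EuclideanSpace.single 0 1) 2 ≠ 0 ∨ fderiv ℝ (v z.1) z.2 (EuclideanSpace.single 1 1) 2 ≠ 0) ∧
          (fderiv ℝ (v z.1) z.2 (EuclideanSpace.single 2 1) 0 ≠ 0 ∨ fderiv ℝ (v z.1) z.2 (EuclideanSpace.single 2 1) 1 ≠ 0)) →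
        (∀ m : ℝ → ℝ, ∀ W₁ : Set (ℝ × EuclideanSpace ℝ (Fin 3)), W₁ ⊆ W → IsOpen W₁ → W₁.Nonempty →
          ∃ z ∈ W₁, ∃ b : Fin 3, b ≠ 2 ∧
            fderiv ℝ (v z.1) z.2 (EuclideanSpace.single 2 1) b ≠
              m z.1 * fderiv ℝ (v z.1) z.2 (EuclideanSpace.single b 1) 2) →
        (∀ z ∈ W,
          fderiv ℝ (fun x => fderiv ℝ (v z.1) x (EuclideanSpace.single 2 1) 2) z.2 (EuclideanSpace.single 0 1) *
              fderiv ℝ (v z.1) z.2 (EuclideanSpace.single 1 1) 2 -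
            fderiv ℝ (fun x => fderiv ℝ (v z.1) x (EuclideanSpace.single 2 1) 2) z.2 (EuclideanSpace.single 1 1) *
              fderiv ℝ (v z.1) z.2 (EuclideanSpace.single 0 1) 2 ≠ 0) →
        (∀ z ∈ W,
          fderiv ℝ (v z.1) z.2 (EuclideanSpace.single 2 1) 0 * fderiv ℝ (v z.1) z.2 (EuclideanSpace.single 0 1) 2 +
            fderiv ℝ (v z.1) z.2 (EuclideanSpace.single 2 1) 1 * fderiv ℝ (v z.1) z.2 (EuclideanSpace.single 1 1) 2 < 0) →
        (∀ m : ℝ → ℝ → ℝ, ∀ W₁ : Set (ℝ × EuclideanSpace ℝ (Fin 3)), W₁ ⊆ W → IsOpen W₁ → W₁.Nonempty →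
          ∃ z ∈ W₁, ∃ b : Fin 3, b ≠ 2 ∧
            fderiv ℝ (v z.1) z.2 (EuclideanSpace.single 2 1) b ≠
              m z.1 (z.2 2) * fderiv ℝ (v z.1) z.2 (EuclideanSpace.single b 1) 2) →
        (¬ ((∃ p : EuclideanSpace ℝ (Fin 3), p ≠ 0 ∧ ∀ t : ℝ, t < 0 → ∀ x, v t (x + p) = v t x) ∨
            ∃ (A : EuclideanSpace ℝ (Fin 3) ≃ₗᵢ[ℝ] EuclideanSpace ℝ (Fin 3)) (c : EuclideanSpace ℝ (Fin 3)),
              (∀ q : ℕ, 0 < q → ∃ x, (fun y => A y)^[q] x ≠ x) ∧ ∀ t : ℝ, t < 0 → ∀ x, v t (A (x - c) + c) = A (v t x))) →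
          ¬ Literature.Analysis.FluidPDE.IsBackwardSingularPoint v 0 := by
  sorry

/-- **STUB R_S (`stub_asymmetricSemiThick`; v1–v2.1 `stub_aperiodicSemiThick`) — research residue: the SEMI-ELLIPTIC-SLAB THICK cell under `¬ HDoor`.**  Binders VERBATIM the
shared cell `stub_semiEllipticThick` of `Lines/mixed_type.lean` v2 / `z_shock.lean` (class; poloidal; non-degenerate twisting window `W` inside a time slab
`(a, b)` all of whose slices are semi-elliptic, `0 ≤ I` everywhere; THICK), plus `¬ HDoor` (v3).  Strictly weaker than
the cell.  Why it might be as hard as the cell: as for R_H; the cell's own lines (strain_tube: pointwise-in-time strain floor; sparse_energy: the class floor, whose velocity half is the tree theorem `FarPastLedger_proof`) attack it;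
the APERIODIC strain-tube witness K-52 `seField` ((M)-free) shows the residue keeps the mild clause for cause (`semiEllipticThick_false_without_mild`). -/
theorem stub_asymmetricSemiThick :
    ∀ (C : ℝ) (v : ℝ → EuclideanSpace ℝ (Fin 3) → EuclideanSpace ℝ (Fin 3)),
      Literature.Analysis.FluidPDE.HasTypeITimeDecay C v →
      ContinuousOn (Function.uncurry v) (Set.Iio (0 : ℝ) ×ˢ Set.univ) →
      (∀ s t : ℝ, s < t → t < 0 → ∀ x, v t x =
        Literature.Analysis.UnboundedOperators.heatExtension (v s) (t - s) x -
          Literature.Analysis.FluidPDE.oseenDuhamel 1 s v v t x) →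
      (∀ t < 0, Literature.Analysis.FluidPDE.VectorCalculus.IsDivFree (v t)) →
      (∀ s < 0, ∀ y, ⟪Literature.Analysis.FluidPDE.curl (v s) y, EuclideanSpace.single 2 1⟫_ℝ = 0) →
      ∀ W : Set (ℝ × EuclideanSpace ℝ (Fin 3)), IsOpen W → W.Nonempty → W ⊆ Set.Iio (0 : ℝ) ×ˢ Set.univ →
        (∀ z ∈ W, Literature.Analysis.FluidPDE.curl (v z.1) z.2 ≠ 0 ∧
          (fderiv ℝ (v z.1) z.2 (EuclideanSpace.single 0 1) 2 ≠ 0 ∨ fderiv ℝ (v z.1) z.2 (EuclideanSpace.single 1 1) 2 ≠ 0) ∧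
          (fderiv ℝ (v z.1) z.2 (EuclideanSpace.single 2 1) 0 ≠ 0 ∨ fderiv ℝ (v z.1) z.2 (EuclideanSpace.single 2 1) 1 ≠ 0)) →
        (∀ m : ℝ → ℝ, ∀ W₁ : Set (ℝ × EuclideanSpace ℝ (Fin 3)), W₁ ⊆ W → IsOpen W₁ → W₁.Nonempty →
          ∃ z ∈ W₁, ∃ b : Fin 3, b ≠ 2 ∧
            fderiv ℝ (v z.1) z.2 (EuclideanSpace.single 2 1) b ≠
              m z.1 * fderiv ℝ (v z.1) z.2 (EuclideanSpace.single b 1) 2) →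
        (∀ z ∈ W,
          fderiv ℝ (fun x => fderiv ℝ (v z.1) x (EuclideanSpace.single 2 1) 2) z.2 (EuclideanSpace.single 0 1) *
              fderiv ℝ (v z.1) z.2 (EuclideanSpace.single 1 1) 2 -
            fderiv ℝ (fun x => fderiv ℝ (v z.1) x (EuclideanSpace.single 2 1) 2) z.2 (EuclideanSpace.single 1 1) *
              fderiv ℝ (v z.1) z.2 (EuclideanSpace.single 0 1) 2 ≠ 0) →
        ∀ a b : ℝ, W ⊆ Set.Ioo a b ×ˢ Set.univ →
          (∀ s ∈ Set.Ioo a b, ∀ y : EuclideanSpace ℝ (Fin 3),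
            0 ≤ fderiv ℝ (v s) y (EuclideanSpace.single 2 1) 0 * fderiv ℝ (v s) y (EuclideanSpace.single 0 1) 2 +
              fderiv ℝ (v s) y (EuclideanSpace.single 2 1) 1 * fderiv ℝ (v s) y (EuclideanSpace.single 1 1) 2) →
          (∀ m : ℝ → ℝ → ℝ, ∀ W₁ : Set (ℝ × EuclideanSpace ℝ (Fin 3)), W₁ ⊆ W → IsOpen W₁ → W₁.Nonempty →
          ∃ z ∈ W₁, ∃ b : Fin 3, b ≠ 2 ∧
            fderiv ℝ (v z.1) z.2 (EuclideanSpace.single 2 1) b ≠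
              m z.1 (z.2 2) * fderiv ℝ (v z.1) z.2 (EuclideanSpace.single b 1) 2) →
        (¬ ((∃ p : EuclideanSpace ℝ (Fin 3), p ≠ 0 ∧ ∀ t : ℝ, t < 0 → ∀ x, v t (x + p) = v t x) ∨
            ∃ (A : EuclideanSpace ℝ (Fin 3) ≃ₗᵢ[ℝ] EuclideanSpace ℝ (Fin 3)) (c : EuclideanSpace ℝ (Fin 3)),
              (∀ q : ℕ, 0 < q → ∃ x, (fun y => A y)^[q] x ≠ x) ∧ ∀ t : ℝ, t < 0 → ∀ x, v t (A (x - c) + c) = A (v t x))) →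
          ¬ Literature.Analysis.FluidPDE.IsBackwardSingularPoint v 0 := by
  sorry

/-! ### Composition, step 1 (proved): the two THICK cells of `twisting_regular_of_three` from the symmetry door and the residues -/

/-- **`stub_hyperbolicThick` (= `hHT` of `twisting_regular_of_three`; shared cell of mixed_type / z_shock) PROVED from this line's stubs**: `HDoor` ⇒
`symmetryDoor` (by name over the tree), otherwise the residue R_H. -/
theorem hyperbolicThick_of_periodDoor :
    ∀ (C : ℝ) (v : ℝ → EuclideanSpace ℝ (Fin 3) → EuclideanSpace ℝ (Fin 3)),
      Literature.Analysis.FluidPDE.HasTypeITimeDecay C v →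
      ContinuousOn (Function.uncurry v) (Set.Iio (0 : ℝ) ×ˢ Set.univ) →
      (∀ s t : ℝ, s < t → t < 0 → ∀ x, v t x =
        Literature.Analysis.UnboundedOperators.heatExtension (v s) (t - s) x -
          Literature.Analysis.FluidPDE.oseenDuhamel 1 s v v t x) →
      (∀ t < 0, Literature.Analysis.FluidPDE.VectorCalculus.IsDivFree (v t)) →
      (∀ s < 0, ∀ y, ⟪Literature.Analysis.FluidPDE.curl (v s) y, EuclideanSpace.single 2 1⟫_ℝ = 0) →
      ∀ W : Set (ℝ × EuclideanSpace ℝ (Fin 3)), IsOpen W → W.Nonempty → W ⊆ Set.Iio (0 : ℝ) ×ˢ Set.univ →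
        (∀ z ∈ W, Literature.Analysis.FluidPDE.curl (v z.1) z.2 ≠ 0 ∧
          (fderiv ℝ (v z.1) z.2 (EuclideanSpace.single 0 1) 2 ≠ 0 ∨ fderiv ℝ (v z.1) z.2 (EuclideanSpace.single 1 1) 2 ≠ 0) ∧
          (fderiv ℝ (v z.1) z.2 (EuclideanSpace.single 2 1) 0 ≠ 0 ∨ fderiv ℝ (v z.1) z.2 (EuclideanSpace.single 2 1) 1 ≠ 0)) →
        (∀ m : ℝ → ℝ, ∀ W₁ : Set (ℝ × EuclideanSpace ℝ (Fin 3)), W₁ ⊆ W → IsOpen W₁ → W₁.Nonempty →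
          ∃ z ∈ W₁, ∃ b : Fin 3, b ≠ 2 ∧
            fderiv ℝ (v z.1) z.2 (EuclideanSpace.single 2 1) b ≠
              m z.1 * fderiv ℝ (v z.1) z.2 (EuclideanSpace.single b 1) 2) →
        (∀ z ∈ W,
          fderiv ℝ (fun x => fderiv ℝ (v z.1) x (EuclideanSpace.single 2 1) 2) z.2 (EuclideanSpace.single 0 1) *
              fderiv ℝ (v z.1) z.2 (EuclideanSpace.single 1 1) 2 -
            fderiv ℝ (fun x => fderiv ℝ (v z.1) x (EuclideanSpace.single 2 1) 2) z.2 (EuclideanSpace.single 1 1) *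
              fderiv ℝ (v z.1) z.2 (EuclideanSpace.single 0 1) 2 ≠ 0) →
        (∀ z ∈ W,
          fderiv ℝ (v z.1) z.2 (EuclideanSpace.single 2 1) 0 * fderiv ℝ (v z.1) z.2 (EuclideanSpace.single 0 1) 2 +
            fderiv ℝ (v z.1) z.2 (EuclideanSpace.single 2 1) 1 * fderiv ℝ (v z.1) z.2 (EuclideanSpace.single 1 1) 2 < 0) →
        (∀ m : ℝ → ℝ → ℝ, ∀ W₁ : Set (ℝ × EuclideanSpace ℝ (Fin 3)), W₁ ⊆ W → IsOpen W₁ → W₁.Nonempty →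
          ∃ z ∈ W₁, ∃ b : Fin 3, b ≠ 2 ∧
            fderiv ℝ (v z.1) z.2 (EuclideanSpace.single 2 1) b ≠
              m z.1 (z.2 2) * fderiv ℝ (v z.1) z.2 (EuclideanSpace.single b 1) 2) →
        ¬ Literature.Analysis.FluidPDE.IsBackwardSingularPoint v 0 := by
  intro C v hrate hcont hmild hdiv hpol W hW hWne hWs hnd hpin htw hhyp hth
  by_cases hdoor : ((∃ p : EuclideanSpace ℝ (Fin 3), p ≠ 0 ∧ ∀ t : ℝ, t < 0 → ∀ x, v t (x + p) = v t x) ∨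
            ∃ (A : EuclideanSpace ℝ (Fin 3) ≃ₗᵢ[ℝ] EuclideanSpace ℝ (Fin 3)) (c : EuclideanSpace ℝ (Fin 3)),
              (∀ q : ℕ, 0 < q → ∃ x, (fun y => A y)^[q] x ≠ x) ∧ ∀ t : ℝ, t < 0 → ∀ x, v t (A (x - c) + c) = A (v t x))
  · exact symmetryDoor C v hrate hcont hmild hdiv hdoor
  · exact stub_asymmetricHypThick C v hrate hcont hmild hdiv hpol W hW hWne hWs hnd hpin htw hhyp hth hdoor

/-- **`stub_semiEllipticThick` (= `hST` of `twisting_regular_of_three`; shared cell) PROVED from this line's stubs**: `HDoor` ⇒ `symmetryDoor`;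
otherwise R_S. -/
theorem semiEllipticThick_of_periodDoor :
    ∀ (C : ℝ) (v : ℝ → EuclideanSpace ℝ (Fin 3) → EuclideanSpace ℝ (Fin 3)),
      Literature.Analysis.FluidPDE.HasTypeITimeDecay C v →
      ContinuousOn (Function.uncurry v) (Set.Iio (0 : ℝ) ×ˢ Set.univ) →
      (∀ s t : ℝ, s < t → t < 0 → ∀ x, v t x =
        Literature.Analysis.UnboundedOperators.heatExtension (v s) (t - s) x -
          Literature.Analysis.FluidPDE.oseenDuhamel 1 s v v t x) →
      (∀ t < 0, Literature.Analysis.FluidPDE.VectorCalculus.IsDivFree (v t)) →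
      (∀ s < 0, ∀ y, ⟪Literature.Analysis.FluidPDE.curl (v s) y, EuclideanSpace.single 2 1⟫_ℝ = 0) →
      ∀ W : Set (ℝ × EuclideanSpace ℝ (Fin 3)), IsOpen W → W.Nonempty → W ⊆ Set.Iio (0 : ℝ) ×ˢ Set.univ →
        (∀ z ∈ W, Literature.Analysis.FluidPDE.curl (v z.1) z.2 ≠ 0 ∧
          (fderiv ℝ (v z.1) z.2 (EuclideanSpace.single 0 1) 2 ≠ 0 ∨ fderiv ℝ (v z.1) z.2 (EuclideanSpace.single 1 1) 2 ≠ 0) ∧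
          (fderiv ℝ (v z.1) z.2 (EuclideanSpace.single 2 1) 0 ≠ 0 ∨ fderiv ℝ (v z.1) z.2 (EuclideanSpace.single 2 1) 1 ≠ 0)) →
        (∀ m : ℝ → ℝ, ∀ W₁ : Set (ℝ × EuclideanSpace ℝ (Fin 3)), W₁ ⊆ W → IsOpen W₁ → W₁.Nonempty →
          ∃ z ∈ W₁, ∃ b : Fin 3, b ≠ 2 ∧
            fderiv ℝ (v z.1) z.2 (EuclideanSpace.single 2 1) b ≠
              m z.1 * fderiv ℝ (v z.1) z.2 (EuclideanSpace.single b 1) 2) →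
        (∀ z ∈ W,
          fderiv ℝ (fun x => fderiv ℝ (v z.1) x (EuclideanSpace.single 2 1) 2) z.2 (EuclideanSpace.single 0 1) *
              fderiv ℝ (v z.1) z.2 (EuclideanSpace.single 1 1) 2 -
            fderiv ℝ (fun x => fderiv ℝ (v z.1) x (EuclideanSpace.single 2 1) 2) z.2 (EuclideanSpace.single 1 1) *
              fderiv ℝ (v z.1) z.2 (EuclideanSpace.single 0 1) 2 ≠ 0) →
        ∀ a b : ℝ, W ⊆ Set.Ioo a b ×ˢ Set.univ →
          (∀ s ∈ Set.Ioo a b, ∀ y : EuclideanSpace ℝ (Fin 3),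
            0 ≤ fderiv ℝ (v s) y (EuclideanSpace.single 2 1) 0 * fderiv ℝ (v s) y (EuclideanSpace.single 0 1) 2 +
              fderiv ℝ (v s) y (EuclideanSpace.single 2 1) 1 * fderiv ℝ (v s) y (EuclideanSpace.single 1 1) 2) →
          (∀ m : ℝ → ℝ → ℝ, ∀ W₁ : Set (ℝ × EuclideanSpace ℝ (Fin 3)), W₁ ⊆ W → IsOpen W₁ → W₁.Nonempty →
          ∃ z ∈ W₁, ∃ b : Fin 3, b ≠ 2 ∧
            fderiv ℝ (v z.1) z.2 (EuclideanSpace.single 2 1) b ≠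
              m z.1 (z.2 2) * fderiv ℝ (v z.1) z.2 (EuclideanSpace.single b 1) 2) →
          ¬ Literature.Analysis.FluidPDE.IsBackwardSingularPoint v 0 := by
  intro C v hrate hcont hmild hdiv hpol W hW hWne hWs hnd hpin htw a b hWab hsemi hth
  by_cases hdoor : ((∃ p : EuclideanSpace ℝ (Fin 3), p ≠ 0 ∧ ∀ t : ℝ, t < 0 → ∀ x, v t (x + p) = v t x) ∨
            ∃ (A : EuclideanSpace ℝ (Fin 3) ≃ₗᵢ[ℝ] EuclideanSpace ℝ (Fin 3)) (c : EuclideanSpace ℝ (Fin 3)),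
              (∀ q : ℕ, 0 < q → ∃ x, (fun y => A y)^[q] x ≠ x) ∧ ∀ t : ℝ, t < 0 → ∀ x, v t (A (x - c) + c) = A (v t x))
  · exact symmetryDoor C v hrate hcont hmild hdiv hdoor
  · exact stub_asymmetricSemiThick C v hrate hcont hmild hdiv hpol W hW hWne hWs hnd hpin htw a b hWab hsemi hth hdoor

/-! ### Composition, step 2 (proved): `stub_twisting`, then the crux (= `mixed_type` v2 / `strain_tube` v2 chain, verbatim) -/

/-- **NON-DEGENERATE + PIN + TWISTING ⇒ regular** — VERBATIM the statement of the registered stub `stub_twisting` of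
`Lines/lrc_jet.lean` v5 (= `mixed_type`'s `twisting_of_mixedType`), PROVED: `hH` from the shared (TH) stub `stub_hyperbolicTH`; BOTH thick cells `hHT`, `hST` from THIS LINE (`hyperbolicThick_of_periodDoor`,
`semiEllipticThick_of_periodDoor`: symmetry door (by name) + residues R_H / R_S under `¬ HDoor`). -/
theorem twisting_of_periodDoor :
    ∀ (C : ℝ) (v : ℝ → EuclideanSpace ℝ (Fin 3) → EuclideanSpace ℝ (Fin 3)),
      Literature.Analysis.FluidPDE.HasTypeITimeDecay C v →
      ContinuousOn (Function.uncurry v) (Set.Iio (0 : ℝ) ×ˢ Set.univ) →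
      (∀ s t : ℝ, s < t → t < 0 → ∀ x, v t x =
        Literature.Analysis.UnboundedOperators.heatExtension (v s) (t - s) x -
          Literature.Analysis.FluidPDE.oseenDuhamel 1 s v v t x) →
      (∀ t < 0, Literature.Analysis.FluidPDE.VectorCalculus.IsDivFree (v t)) →
      (∀ s < 0, ∀ y, ⟪Literature.Analysis.FluidPDE.curl (v s) y, EuclideanSpace.single 2 1⟫_ℝ = 0) →
      ∀ W : Set (ℝ × EuclideanSpace ℝ (Fin 3)), IsOpen W → W.Nonempty → W ⊆ Set.Iio (0 : ℝ) ×ˢ Set.univ →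
        (∀ z ∈ W, Literature.Analysis.FluidPDE.curl (v z.1) z.2 ≠ 0 ∧
          (fderiv ℝ (v z.1) z.2 (EuclideanSpace.single 0 1) 2 ≠ 0 ∨ fderiv ℝ (v z.1) z.2 (EuclideanSpace.single 1 1) 2 ≠ 0) ∧
          (fderiv ℝ (v z.1) z.2 (EuclideanSpace.single 2 1) 0 ≠ 0 ∨ fderiv ℝ (v z.1) z.2 (EuclideanSpace.single 2 1) 1 ≠ 0)) →
        (∀ m : ℝ → ℝ, ∀ W₁ : Set (ℝ × EuclideanSpace ℝ (Fin 3)), W₁ ⊆ W → IsOpen W₁ → W₁.Nonempty →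
          ∃ z ∈ W₁, ∃ b : Fin 3, b ≠ 2 ∧
            fderiv ℝ (v z.1) z.2 (EuclideanSpace.single 2 1) b ≠
              m z.1 * fderiv ℝ (v z.1) z.2 (EuclideanSpace.single b 1) 2) →
        (∀ z ∈ W,
          fderiv ℝ (fun x => fderiv ℝ (v z.1) x (EuclideanSpace.single 2 1) 2) z.2 (EuclideanSpace.single 0 1) *
              fderiv ℝ (v z.1) z.2 (EuclideanSpace.single 1 1) 2 -
            fderiv ℝ (fun x => fderiv ℝ (v z.1) x (EuclideanSpace.single 2 1) 2) z.2 (EuclideanSpace.single 1 1) *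
              fderiv ℝ (v z.1) z.2 (EuclideanSpace.single 0 1) 2 ≠ 0) →
        ¬ Literature.Analysis.FluidPDE.IsBackwardSingularPoint v 0 := by
  intro C v hrate hcont hmild hdiv hpol W hW hWne hWs hnd hpin htw
  refine twisting_regular_of_three C v hrate hcont hmild hdiv ?_ ?_ ?_ W hW hWne hWs hnd hpin htw
  · -- hH : hyperbolic (TH) windows
    intro W' hW' hW'ne hW's hnd' hpin' htw' hhyp' hTH'
    exact stub_hyperbolicTH C v hrate hcont hmild hdiv hpol W' hW' hW'ne hW's hnd' hpin' htw' hhyp' hTH'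
  · -- hHT : hyperbolic thick windows (THIS LINE: symmetryDoor | R_H)
    intro W' hW' hW'ne hW's hnd' hpin' htw' hhyp' hth'
    exact hyperbolicThick_of_periodDoor C v hrate hcont hmild hdiv hpol W' hW' hW'ne hW's hnd' hpin' htw' hhyp' hth'
  · -- hST : twisting thick windows inside a semi-elliptic slab (THIS LINE: symmetryDoor | R_S)
    intro W' hW' hW'ne hW's hnd' hpin' htw' a b hWab hsemi hth'
    exact semiEllipticThick_of_periodDoor C v hrate hcont hmild hdiv hpol W' hW' hW'ne hW's hnd' hpin' htw' a b hWab hsemi hth'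

/-! ### Composition, step 2 (proved, = `mixed_type` v2 / `lrc_jet` v5 chain): the crux -/

/-- **NON-DEGENERATE + PIN ⇒ regular** — the pointwise twist dichotomy over the tree theorem `…StubUntwisted.stub_untwisted`
(p561151, the untwisted half) and `twisting_of_periodDoor` (the twisting half). -/
theorem ndRegular :
    ∀ (C : ℝ) (v : ℝ → EuclideanSpace ℝ (Fin 3) → EuclideanSpace ℝ (Fin 3)),
      Literature.Analysis.FluidPDE.HasTypeITimeDecay C v →
      ContinuousOn (Function.uncurry v) (Set.Iio (0 : ℝ) ×ˢ Set.univ) →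
      (∀ s t : ℝ, s < t → t < 0 → ∀ x, v t x =
        Literature.Analysis.UnboundedOperators.heatExtension (v s) (t - s) x -
          Literature.Analysis.FluidPDE.oseenDuhamel 1 s v v t x) →
      (∀ t < 0, Literature.Analysis.FluidPDE.VectorCalculus.IsDivFree (v t)) →
      (∀ s < 0, ∀ y, ⟪Literature.Analysis.FluidPDE.curl (v s) y, EuclideanSpace.single 2 1⟫_ℝ = 0) →
      ∀ W : Set (ℝ × EuclideanSpace ℝ (Fin 3)), IsOpen W → W.Nonempty → W ⊆ Set.Iio (0 : ℝ) ×ˢ Set.univ →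
        (∀ z ∈ W, Literature.Analysis.FluidPDE.curl (v z.1) z.2 ≠ 0 ∧
          (fderiv ℝ (v z.1) z.2 (EuclideanSpace.single 0 1) 2 ≠ 0 ∨ fderiv ℝ (v z.1) z.2 (EuclideanSpace.single 1 1) 2 ≠ 0) ∧
          (fderiv ℝ (v z.1) z.2 (EuclideanSpace.single 2 1) 0 ≠ 0 ∨ fderiv ℝ (v z.1) z.2 (EuclideanSpace.single 2 1) 1 ≠ 0)) →
        (∀ m : ℝ → ℝ, ∀ W₁ : Set (ℝ × EuclideanSpace ℝ (Fin 3)), W₁ ⊆ W → IsOpen W₁ → W₁.Nonempty →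
          ∃ z ∈ W₁, ∃ b : Fin 3, b ≠ 2 ∧
            fderiv ℝ (v z.1) z.2 (EuclideanSpace.single 2 1) b ≠
              m z.1 * fderiv ℝ (v z.1) z.2 (EuclideanSpace.single b 1) 2) →
        ¬ Literature.Analysis.FluidPDE.IsBackwardSingularPoint v 0 := by
  intro C v hrate hcont hmild hdiv hpol W hW hWne hWs hnd hpin
  set T : ℝ × EuclideanSpace ℝ (Fin 3) → ℝ := fun z =>
    fderiv ℝ (fun x => fderiv ℝ (v z.1) x (EuclideanSpace.single 2 1) 2) z.2 (EuclideanSpace.single 0 1) *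
              fderiv ℝ (v z.1) z.2 (EuclideanSpace.single 1 1) 2 -
            fderiv ℝ (fun x => fderiv ℝ (v z.1) x (EuclideanSpace.single 2 1) 2) z.2 (EuclideanSpace.single 1 1) *
              fderiv ℝ (v z.1) z.2 (EuclideanSpace.single 0 1) 2 with hT
  by_cases htw : ∃ z ∈ W, T z ≠ 0
  · obtain ⟨z₀, hz₀W, hz₀⟩ := htw
    have hslab : IsOpen (Set.Iio (0 : ℝ) ×ˢ (Set.univ : Set (EuclideanSpace ℝ (Fin 3)))) :=
      isOpen_Iio.prod isOpen_univ
    have hTc : ContinuousOn T (Set.Iio (0 : ℝ) ×ˢ Set.univ) := by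
      rw [hT]
      exact continuousOn_twist hrate hcont hmild
    have hO : IsOpen ((Set.Iio (0 : ℝ) ×ˢ Set.univ) ∩ T ⁻¹' {0}ᶜ) :=
      hTc.isOpen_inter_preimage hslab isOpen_compl_singleton
    set W₃ : Set (ℝ × EuclideanSpace ℝ (Fin 3)) := W ∩ ((Set.Iio (0 : ℝ) ×ˢ Set.univ) ∩ T ⁻¹' {0}ᶜ) with hW₃
    have hW₃o : IsOpen W₃ := hW.inter hO
    have hW₃W : W₃ ⊆ W := Set.inter_subset_left
    have hW₃ne : W₃.Nonempty := ⟨z₀, hz₀W, hWs hz₀W, hz₀⟩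
    refine twisting_of_periodDoor C v hrate hcont hmild hdiv hpol W₃ hW₃o hW₃ne (hW₃W.trans hWs)
      (fun z hz => hnd z (hW₃W hz)) (fun m W₁ hW₁ hW₁o hW₁ne => hpin m W₁ (hW₁.trans hW₃W) hW₁o hW₁ne) ?_
    intro z hz
    exact hz.2.2
  · push Not at htw
    exact Summit.NavierStokesRegularity.NavierStokesRegularity.Theorems.PoloidalWindowDoorPoloidalWindowRigidityStubUntwisted.stub_untwisted
      C v hrate hcont hmild hdiv hpol W hW hWne hWs hnd htw

/-- **LRC″ with spatial pins, UNDER THE SINGULARITY ASSUMPTION** (vacuously, from `ndRegular`) — the hypothesis `hLRC` of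
`…K2OfLrcSpatial.nonflatLiouville_of_lrc_spatial`. -/
theorem lrcSpatial_of_stubs :
    ∀ (C : ℝ) (v : ℝ → EuclideanSpace ℝ (Fin 3) → EuclideanSpace ℝ (Fin 3)),
      Literature.Analysis.FluidPDE.HasTypeITimeDecay C v →
      ContinuousOn (Function.uncurry v) (Set.Iio (0 : ℝ) ×ˢ Set.univ) →
      (∀ s t : ℝ, s < t → t < 0 → ∀ x, v t x =
        Literature.Analysis.UnboundedOperators.heatExtension (v s) (t - s) x -
          Literature.Analysis.FluidPDE.oseenDuhamel 1 s v v t x) →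
      (∀ t < 0, Literature.Analysis.FluidPDE.VectorCalculus.IsDivFree (v t)) →
      (∀ s < 0, ∀ y, ⟪Literature.Analysis.FluidPDE.curl (v s) y, EuclideanSpace.single 2 1⟫_ℝ = 0) →
      Literature.Analysis.FluidPDE.IsBackwardSingularPoint v 0 →
      ∀ W : Set (ℝ × EuclideanSpace ℝ (Fin 3)), IsOpen W → W.Nonempty → W ⊆ Set.Iio (0 : ℝ) ×ˢ Set.univ →
        (∀ z ∈ W, Literature.Analysis.FluidPDE.curl (v z.1) z.2 ≠ 0 ∧
          (fderiv ℝ (v z.1) z.2 (EuclideanSpace.single 0 1) 2 ≠ 0 ∨ fderiv ℝ (v z.1) z.2 (EuclideanSpace.single 1 1) 2 ≠ 0) ∧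
          (fderiv ℝ (v z.1) z.2 (EuclideanSpace.single 2 1) 0 ≠ 0 ∨ fderiv ℝ (v z.1) z.2 (EuclideanSpace.single 2 1) 1 ≠ 0)) →
        (∀ m : ℝ → ℝ, ∀ W₁ : Set (ℝ × EuclideanSpace ℝ (Fin 3)), W₁ ⊆ W → IsOpen W₁ → W₁.Nonempty →
          ∃ z ∈ W₁, ∃ b : Fin 3, b ≠ 2 ∧
            fderiv ℝ (v z.1) z.2 (EuclideanSpace.single 2 1) b ≠
              m z.1 * fderiv ℝ (v z.1) z.2 (EuclideanSpace.single b 1) 2) →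
        ∃ s : ℝ, s < 0 ∧ ∃ U : Set (EuclideanSpace ℝ (Fin 3)), IsOpen U ∧ U.Nonempty ∧
          ((∃ e : EuclideanSpace ℝ (Fin 3), e ≠ 0 ∧ ∀ y ∈ U, fderiv ℝ (Literature.Analysis.FluidPDE.curl (v s)) y e = 0) ∨
           (∃ c : EuclideanSpace ℝ (Fin 3), ∀ y ∈ U,
              Literature.Analysis.FluidPDE.rotGen (Literature.Analysis.FluidPDE.curl (v s) y) =
                fderiv ℝ (Literature.Analysis.FluidPDE.curl (v s)) y (Literature.Analysis.FluidPDE.rotGen (y - c)))) := by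
  intro C v hrate hcont hmild hdiv hpol hsing W hW hWne hWs hnd hpin
  exact absurd hsing (ndRegular C v hrate hcont hmild hdiv hpol W hW hWne hWs hnd hpin)

/-- **(TV) — both halves are tree theorems** (`…TimeShearLiminf.stub_tvLiminf`, p525351, and
`…HorizontalFlatPast.nonflatLiouville_of_timeShear_unbounded`): the hypothesis `hTV` of
`…K2OfLrcSpatial.nonflatLiouville_of_lrc_spatial`. -/
theorem tv_of_stubs :
    ∀ (C : ℝ) (v : ℝ → EuclideanSpace ℝ (Fin 3) → EuclideanSpace ℝ (Fin 3)),
      Literature.Analysis.FluidPDE.HasTypeITimeDecay C v →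
      ContinuousOn (Function.uncurry v) (Set.Iio (0 : ℝ) ×ˢ Set.univ) →
      (∀ s t : ℝ, s < t → t < 0 → ∀ x, v t x =
        Literature.Analysis.UnboundedOperators.heatExtension (v s) (t - s) x -
          Literature.Analysis.FluidPDE.oseenDuhamel 1 s v v t x) →
      (∀ t < 0, Literature.Analysis.FluidPDE.VectorCalculus.IsDivFree (v t)) →
      (∀ s < 0, ∀ y, ⟪Literature.Analysis.FluidPDE.curl (v s) y, EuclideanSpace.single 2 1⟫_ℝ = 0) →
      ∀ μ : ℝ → ℝ, (∀ s < 0, μ s < 0) → (∀ s < 0, AnalyticAt ℝ μ s) →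
        (∃ s₁ s₂ : ℝ, s₁ < 0 ∧ s₂ < 0 ∧ μ s₁ ≠ μ s₂) →
        (∀ s < 0, ∀ y, ∀ b : Fin 3, b ≠ 2 →
          fderiv ℝ (v s) y (EuclideanSpace.single 2 1) b = μ s * fderiv ℝ (v s) y (EuclideanSpace.single b 1) 2) →
        ¬ Literature.Analysis.FluidPDE.IsBackwardSingularPoint v 0 := by
  intro C v hrate hcont hmild hdiv hpol μ hneg han hnc hslope
  by_cases hB : ∃ M : ℝ, ∀ T : ℝ, ∃ τ < T, -M ≤ μ τ
  · exact Summit.NavierStokesRegularity.NavierStokesRegularity.Theorems.PoloidalWindowDoorPoloidalWindowRigidityTimeShearLiminf.stub_tvLiminf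
      C v hrate hcont hmild hdiv hpol μ hneg han hnc hslope hB
  · push Not at hB
    refine nonflatLiouville_of_timeShear_unbounded hrate hcont hmild hdiv hpol hslope fun M => ?_
    obtain ⟨T, hT⟩ := hB M
    refine ⟨T, fun τ hτ => ?_⟩
    have h1 : μ τ < -M := hT τ hτ
    have h2 : M < -μ τ := by linarith
    exact h2.le.trans (neg_le_abs (μ τ))

/-- **The slice-sharp residue from the stubs** (symmetry/genericity hypotheses unused): class + poloidal ⇒ not backward-singular,
by contradiction through `…K2OfLrcSpatial.nonflatLiouville_of_lrc_spatial`. -/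
theorem sliceSharpNonflatLiouville_of_periodDoor :
    ∀ (C : ℝ) (v : ℝ → EuclideanSpace ℝ (Fin 3) → EuclideanSpace ℝ (Fin 3)),
      Literature.Analysis.FluidPDE.HasTypeITimeDecay C v →
      ContinuousOn (Function.uncurry v) (Set.Iio (0 : ℝ) ×ˢ Set.univ) →
      (∀ s t : ℝ, s < t → t < 0 → ∀ x, v t x =
        Literature.Analysis.UnboundedOperators.heatExtension (v s) (t - s) x -
          Literature.Analysis.FluidPDE.oseenDuhamel 1 s v v t x) →
      (∀ t < 0, Literature.Analysis.FluidPDE.VectorCalculus.IsDivFree (v t)) →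
      (∀ s < 0, ∀ y, ⟪Literature.Analysis.FluidPDE.curl (v s) y, EuclideanSpace.single 2 1⟫_ℝ = 0) →
      (∀ s < 0, ∀ y, ⟪fderiv ℝ (v s) y (Literature.Analysis.FluidPDE.curl (v s) y), EuclideanSpace.single 2 1⟫_ℝ = 0) →
      (∀ s < 0, ∀ b : EuclideanSpace ℝ (Fin 3), b ≠ 0 → ∃ y,
        Literature.Analysis.FluidPDE.cross (Literature.Analysis.FluidPDE.curl (v s) y) b ≠ 0) →
      (∀ s < 0, ∃ y, fderiv ℝ (v s) y (EuclideanSpace.single 2 1) 0 ≠ 0 ∨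
        fderiv ℝ (v s) y (EuclideanSpace.single 2 1) 1 ≠ 0) →
      (∀ s < 0, ∀ a : EuclideanSpace ℝ (Fin 3), a ≠ 0 → ⟪a, EuclideanSpace.single 2 1⟫_ℝ = 0 →
        ∃ y, ⟪fderiv ℝ (v s) y a, EuclideanSpace.single 2 1⟫_ℝ ≠ 0) →
      (∀ s < 0, ∀ e : EuclideanSpace ℝ (Fin 3), e ≠ 0 → ∃ (y : EuclideanSpace ℝ (Fin 3)) (l : ℝ), v s (y + l • e) ≠ v s y) →
      (∀ s < 0, ∀ (L : EuclideanSpace ℝ (Fin 3) ≃ₗᵢ[ℝ] EuclideanSpace ℝ (Fin 3)) (c : EuclideanSpace ℝ (Fin 3)),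
        ¬ Literature.Analysis.FluidPDE.IsAxisymmetric (fun y => L.symm (v s (L y + c)))) →
      (∃ lam : ℝ, 0 < lam ∧ ∃ s < 0, ∃ y, lam • v (lam ^ 2 * s) (lam • y) ≠ v s y) →
        ¬ Literature.Analysis.FluidPDE.IsBackwardSingularPoint v 0 := by
  intro C v hrate hcont hmild hdiv hpol _ _ _ _ _ _ _ hsing
  exact nonflatLiouville_of_lrc_spatial hrate hcont hmild hdiv hpol
    (lrcSpatial_of_stubs C v hrate hcont hmild hdiv hpol hsing) (tv_of_stubs C v hrate hcont hmild hdiv hpol) hsing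

/-- **COMPOSITION (proved): the crux `PoloidalWindowRigidity` BY NAME** from this line's stubs `stub_killingOfDiscreteRotation` (D1F, geometry;
with it the SYMMETRY DOOR `symmetryDoor` is PROVED by name over `periodicTypeIAncientLiouville` / `AxisymEndLiouville_of`), `stub_asymmetricHypThick` /
`stub_asymmetricSemiThick` (R_H / R_S, research residues: the two THICK cells under `¬ HDoor`) and the shared stub `stub_hyperbolicTH` ((TH);
string_shells / entire_slices / local_rigidity), via the landed reduction `…Sharper.poloidalWindowRigidity_of_sliceSharpNonflatLiouville`.
No summit is proved: four `sorry`s, all inside `stub_*`. -/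
theorem PoloidalWindowRigidity_of_periodDoor :
    Summit.NavierStokesRegularity.NavierStokesRegularity.Theses.PoloidalWindowDoor.PoloidalWindowRigidity :=
  poloidalWindowRigidity_of_sliceSharpNonflatLiouville sliceSharpNonflatLiouville_of_periodDoor

end Summit.NavierStokesRegularity.NavierStokesRegularity.Cruxes.PoloidalWindowRigidity.PeriodDoor
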